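/-
Copyright (c) 2026 the pub-hodgecm-mathlib formalisation cell (harness21).  Prover seat hodgecm-mathlib-LH6-p03 (g11), 2026-09-03.  EXT-ROAD v2 «12.6.1 (b)-REST OUTSIDE EP PAIRS,
NOT-WILD `v`» (heir LEAD F0P3a-plan (g17) T16-03 piece (3) «(X0′-NW)»; keeper k119 (c)), FILE NW-C of 3: the NOT-WILD socket the assembly head (X3′) calls.
-/
import Summits.HodgeConjecture.HodgeConjecture.Theorems.F0P3cStCharTSEPCrossNormZeroTame   -- FILE NW-B (this seat): §3-RAM `innerG_char_cross_eq_zero_of_neg_explicit` (the tame branch); brings row-80 FILE B (F0P3-p02 g27) §3 `innerG_char_cross_eq_zero_of_unramified_explicit` (the unramified branch), ★ 73 (its §NW case split is the pattern), ★ 72-NW (★ `ramifiedBlock_adicCompletion`, ★ `valued_two_eq_one_iff_of_placesOver`, ★ `isUnramifiedIn_of_ramificationIdx'_eq_one`, ★ `galAdicCompletionMap_galAdicCompletionMap_of_smul_eq`)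
import HarnessLib

/-!
# F0 · P3c · «StCharTS» EXT-ROAD v2 (X0′-NW), FILE NW-C — CROSS-NORM-ZERO UNDER THE NOT-WILD PLACE TOKEN, junction letters: the socket
# `innerG_char_cross_eq_zero_of_not_wild (hns) (hv : v unramified in L ∨ |2|_v = 1) … (r) (r′) (hsplit₂) (hHom0) : ⟨χ_⟦r′⟧, χ_⟦r⟧⟩_e = 0` that the assembly head (X3′)
# `isEllipticPair_of_innerG_ne_zero_of_not_wild` calls (heir LEAD T16-03 (3): «THE SOCKET (X3′) CALLS — the ride is NOT-WILD, the UNR head alone is not enough»)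

Cell `pub/hodgecm-mathlib` (D-0151), crux H413 = `stmt-HodgeConjecture-24833` (`--supports` lane, `--as helper`: THEOREMS ONLY — no definition ∕ instance ∕ notation ∕ named fact ∕
`sorry`; count-neutral: closes no node).  Namespace `Summit.HodgeConjecture.HodgeConjecture.Cruxes.H413.F0P3cStCharTSEPCrossNormZeroNotWild`.  Seat «LH6» LH6-p03 (g11).
ONE theorem, the place-token twin of row-80 FILE B §4 `innerG_char_cross_eq_zero_of_unramified (hns) (hunr) …` (F0P3-p02 (g27)): binders = FILE B §4's VERBATIM with `hunr` replaced by
the NOT-WILD disjunction `hv : Algebra.IsUnramifiedIn (𝓞 L) v.asIdeal ∨ Valued.v (2 : v.adicCompletion ↥(maximalRealSubfield L)) = 1` (rule-26 token; = the union ★ 73 §NW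
`innerG_char_self_eq_one_of_hsplit_of_not_wild` takes, with ★ 73's self-`hsplit` replaced by the cross letters `(r′) (hsplit₂) (hHom0)`); conclusion VERBATIM
`𝔇.innerG (𝔇.char (IrrClass.mk r')) (𝔇.char (IrrClass.mk r)) = 0`.  Proof = ★ 73 §NW's place-token case split VERBATIM: pick `w ∣ v` and the one-place model `eA` (★ `localNonsplitEquiv`
re-read on `Φ₃`); if `v` is unramified, ★ `unramifiedLocalConjDatum_adicCompletion` and FILE B §3 `innerG_char_cross_eq_zero_of_unramified_explicit`; else `e(w∣v) = 1` is again unramified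
(★ `isUnramifiedIn_of_ramificationIdx'_eq_one`), and `e(w∣v) ≠ 1` with `|2|_w = 1` (★ `valued_two_eq_one_iff_of_placesOver`) gives the tame block (★ `ramifiedBlock_adicCompletion`) with the
place-free `σσ = 1` ∕ `|σ·| = |·|` (★ `galAdicCompletionMap_galAdicCompletionMap_of_smul_eq`, ★ `valued_galAdicCompletionMap`) and FILE NW-B §3-RAM `innerG_char_cross_eq_zero_of_neg_explicit`.
NO `IsL2` ∕ `IsEllipticRep` ∕ `IsSupercuspidal` ∕ unitarity ∕ self-`hsplit` letter; NO HOME-only binder.  EXT-ROAD v2 (S-A) reads it contrapositively at a not-wild `v`: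
`⟨χ_⟦r′⟧, χ_⟦r⟧⟩_e ≠ 0 ⇒ Hom_G(r, r′) ≠ 0 ∨` some smooth extension of `r` by `r′` does not split (then ★ 79 (SEP) ∕ case A of T16-03).
HONEST LABEL: count-neutral helper; WILD (`v ∣ 2` ramified in `L`) = PRINT of record (CENSUS-R74); Prop. 12.6.1 (b)-rest stays PRINT of record until the rider «(b)-REST NOT-WILD» (T16-03)
rides; h413 OPEN; HC_CM is proved only modulo the 7 printed citations (2 remaining named inputs hLiu418 = stmt-HodgeConjecture-24832, h413 = stmt-HodgeConjecture-24833) until rung 0 closes;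
nothing printed is asserted here.

## References
* [Rogawski1990] J. D. Rogawski, *Automorphic Representations of Unitary Groups in Three Variables*, Ann. of Math. Stud. 123 (1990): §12.6 p. 187 (`Tr π′(f_π) = ⟨χ_{π′}, χ_π⟩_e`),
  Prop. 12.6.1 (b) p. 188.
* [SchneiderStuhler1997] P. Schneider, U. Stuhler, *Representation theory and sheaves on the Bruhat–Tits building*, Publ. Math. IHÉS 85 (1997): §III.4 Thm. III.4.16 ff.
* [Kottwitz1988] R. E. Kottwitz, *Tamagawa numbers*, Ann. of Math. 127 (1988): §2 Theorem 2.
-/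

set_option autoImplicit false

set_option linter.dupNamespace false

noncomputable section

open NumberField IsDedekindDomain MeasureTheory Filter Topology
open scoped Matrix MatrixGroups Pointwise Valued WithZero ComplexConjugate
open Literature.NumberTheory.Rogawski1990 Literature.NumberTheory.Rogawski1990.Ch12Sec5
open Literature.NumberTheory.Automorphic Literature.NumberTheory.Automorphic.UnitaryGroup Literature.NumberTheory.Automorphic.UnitaryLatticeTree
open Literature.NumberTheory.Automorphic.HermitianLattice
open Literature.NumberTheory.GaloisRepresentations
open Literature.Combinatorics.SimpleGraph Literature.Combinatorics.SimpleGraph.OrientedIncidence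
open Literature.NumberTheory.Automorphic.Liu2021.LemD1IndexedNonVacuityTameSynthesis (isUnramifiedIn_of_ramificationIdx'_eq_one)

namespace Summit.HodgeConjecture.HodgeConjecture.Cruxes.H413.F0P3cStCharTSEPCrossNormZeroNotWild
open Summit.HodgeConjecture.HodgeConjecture.Cruxes.H413 Summit.HodgeConjecture.HodgeConjecture.Cruxes.H413.F0P3cStCharTSTorusDefs
open Summit.HodgeConjecture.HodgeConjecture.Cruxes.H413.F0P3cStCharTSEPCrossNormZeroUnr
open Summit.HodgeConjecture.HodgeConjecture.Cruxes.H413.F0P3cStCharTSEPCrossNormZeroTame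

section Head

variable (L : Type) [Field L] [NumberField L] [IsCMField L] (v : HeightOneSpectrum (𝓞 ↥(maximalRealSubfield L)))

/-! ## §NW CROSS-NORM-ZERO UNDER THE NOT-WILD PLACE TOKEN, junction letters (★ 73 §NW's case split over FILE B §3 and FILE NW-B §3-RAM) — the socket (X3′) calls -/

/-- **§NW CROSS-NORM-ZERO, junction letters, NOT-WILD place token.**  At a non-split place `v` with `hv : v unramified in L ∨ |2|_v = 1`, at the §12.5 datum with the junction pins
`hμG horb hreg hE hM1` and ★ PCT-OUT's letters `hWIF hC1 hC2 hC3 hL2`: for irreducible smooth `r`, `r′` of `U(Φ₃)(L⁺_v)` with `hsplit₂` (every SMOOTH extension `0 → r′ → E → r → 0` splits,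
★ (J′)'s text at `V := r.ρ`, `W := r′.ρ`) and `hHom0` (`Hom_G(r, r′) = 0`), **`⟨χ_⟦r′⟧, χ_⟦r⟧⟩_e = 0`**.  Binders = row-80 FILE B §4's VERBATIM with `hunr ↦ hv`; proof = ★ 73 §NW's case split
VERBATIM (`hunr` ⇒ the unramified datum and FILE B §3; else `e(w∣v) = 1` ⇒ unramified again; else `|2|_w = 1` ⇒ the tame block ★ `ramifiedBlock_adicCompletion` and FILE NW-B §3-RAM).
This is the socket the assembly head (X3′) `isEllipticPair_of_innerG_ne_zero_of_not_wild (hns) (hv) …` calls (heir LEAD T16-03 (3)); rule-26 token `hv`.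
[cite: Rogawski1990, §12.6 p. 187; Prop. 12.6.1 (b) p. 188] [cite: SchneiderStuhler1997, §III.4] [cite: Kottwitz1988, §2] -/
theorem innerG_char_cross_eq_zero_of_not_wild
    (hns : ∀ w : PlacesOver L v, IsCMField.complexConj L • w.1 = w.1) (hv : Algebra.IsUnramifiedIn (𝓞 L) v.asIdeal ∨ Valued.v (2 : v.adicCompletion ↥(maximalRealSubfield L)) = 1)
    [MeasurableSpace (Gqs L v)] [BorelSpace (Gqs L v)]
    [∀ γ : Gqs L v, MeasurableSpace (Gqs L v ⧸ Subgroup.centralizer ({γ} : Set (Gqs L v)))] [∀ γ : Gqs L v, BorelSpace (Gqs L v ⧸ Subgroup.centralizer ({γ} : Set (Gqs L v)))]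
    [MeasurableSpace (Gqs L v ⧸ Subgroup.center (Gqs L v))]
    {H : Type} [Group H] [TopologicalSpace H] [IsTopologicalGroup H] [MeasurableSpace H]
    (νQv : Measure (Gqs L v)) [νQv.IsHaarMeasure] [νQv.IsMulRightInvariant] (mQv : OrbitalMeasureFamily (Gqs L v))
    (hcanQ : mQv.IsCanonical (fun γ => IsRegularElt (γ.val : GL (Fin 3) (UnitaryGroup.LocalRing L v))) νQv)
    (𝔇 : EllipticData (Gqs L v) H) (hμG : 𝔇.μG = νQv) (horb : 𝔇.orb = mQv)
    (hreg : ∀ γ : Gqs L v, γ ∈ 𝔇.regG ↔ IsRegularElt (γ.val : GL (Fin 3) (UnitaryGroup.LocalRing L v)))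
    (hE : ∀ γ : Gqs L v, γ ∈ 𝔇.ellG ↔ IsRegularElt (γ.val : GL (Fin 3) (UnitaryGroup.LocalRing L v)) ∧ γ ∉ hyperbolicSet L v)
    (hM1 : ∀ π : IrrClass (Gqs L v), Measurable (𝔇.char π) ∧ LocallyIntegrable (𝔇.char π) 𝔇.μG ∧ (∀ x ∈ 𝔇.regG, ∀ᶠ y in 𝓝 x, 𝔇.char π y = 𝔇.char π x) ∧
      ∀ φ : Gqs L v → ℂ, IsLocSmooth φ → π.smoothTrace 𝔇.μG φ = ∫ x, φ x * 𝔇.char π x ∂𝔇.μG)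
    (hWIF : 𝔇.WeylIntegrationFormula) (hC1 : 𝔇.EllCartanSubset) (hC2 : 𝔇.EllCartanAE) (hC3 : 𝔇.NonEllCartanAE) (hL2 : 𝔇.L2CharOnTorusAll)   -- ★ PCT-OUT's extra letters
    (r : SmoothIrrep (Gqs L v))
    -- the CROSS letters: a second irreducible smooth `r′`; every SMOOTH extension of `r.ρ` BY `r′.ρ` splits (★ (J′)'s text at `V := r.ρ`, `W := r′.ρ`); `Hom_G(r, r′) = 0`
    (r' : SmoothIrrep (Gqs L v))
    (hsplit₂ : ∀ (E : Type) [AddCommGroup E] [Module ℂ E] (ρE : Representation ℂ (Gqs L v) E), ρE.IsSmooth →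
      ∀ (i : r'.ρ.IntertwiningMap ρE) (p : ρE.IntertwiningMap r.ρ), Function.Injective i → LinearMap.ker p.toLinearMap = LinearMap.range i.toLinearMap →
        Function.Surjective p → ∃ s : r.ρ.IntertwiningMap ρE, p.comp s = Representation.IntertwiningMap.id r.ρ)
    (hHom0 : Subsingleton (r.ρ.IntertwiningMap r'.ρ)) :
    𝔇.innerG (𝔇.char (IrrClass.mk r')) (𝔇.char (IrrClass.mk r)) = 0 := by
  obtain ⟨w⟩ : Nonempty (PlacesOver L v) := inferInstance
  have hw : IsCMField.complexConj L • w.1 = w.1 := hns w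
  have hc1 : IsCMField.complexConj L ≠ 1 := IsCMField.complexConj_ne_one L
  -- the one-place model re-read on the literal form `Φ₃ = antidiag(1,1,1)` (★ (G3) :189–:196)
  have hJw : placeForm (qsForm L) w.1 = (StdForm.antidiagonal 3).over (w.1.adicCompletion L) := by
    rw [placeForm, qsForm, antidiagOne_eq_over, StdForm.over_map]
  obtain ⟨eA, heA⟩ : ∃ eA : Gqs L v ≃ₜ* ↥(unitaryGroupOfForm (galAdicCompletionMap (L := L) (IsCMField.complexConj L) hw) ((StdForm.antidiagonal 3).over (w.1.adicCompletion L))),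
      ∀ g : Gqs L v, ((eA g : ↥(unitaryGroupOfForm (galAdicCompletionMap (L := L) (IsCMField.complexConj L) hw) ((StdForm.antidiagonal 3).over (w.1.adicCompletion L)))) :
          GL (Fin 3) (w.1.adicCompletion L)) =
        ((localNonsplitEquiv (IsCMField.complexConj L) (qsForm L) hc1 w hw g :
          ↥(unitaryGroupOfForm (galAdicCompletionMap (L := L) (IsCMField.complexConj L) hw) (placeForm (qsForm L) w.1))) : GL (Fin 3) (w.1.adicCompletion L)) := by
    rw [← hJw]
    exact ⟨localNonsplitEquiv (IsCMField.complexConj L) (qsForm L) hc1 w hw, fun g => rfl⟩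
  -- the place token: unramified (the datum, FILE B §3) or odd residue characteristic (the tame block, FILE NW-B §3-RAM), exactly as ★ 73 §NW ∕ ★ (G3)-NOT-WILD ∕ ★ 72-NW §T1
  rcases hv with hunr | h2v
  · obtain ⟨ϖ, hd⟩ := unramifiedLocalConjDatum_adicCompletion (IsCMField.complexConj L) hc1 v w hw hunr
    exact F0P3cStCharTSEPCrossNormZeroUnr.innerG_char_cross_eq_zero_of_unramified_explicit L v hns w hw hd eA heA νQv mQv hcanQ 𝔇 hμG horb hreg hE hM1 hWIF hC1 hC2 hC3 hL2 r r' hsplit₂ hHom0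
  · by_cases he : v.asIdeal.ramificationIdx' w.1.asIdeal = 1
    · haveI : Algebra.IsQuadraticExtension ↥(maximalRealSubfield L) L := IsCMField.isQuadraticExtension L
      have hunr : Algebra.IsUnramifiedIn (𝓞 L) v.asIdeal := isUnramifiedIn_of_ramificationIdx'_eq_one L (IsCMField.complexConj L) v hc1 w hw he
      obtain ⟨ϖ, hd⟩ := unramifiedLocalConjDatum_adicCompletion (IsCMField.complexConj L) hc1 v w hw hunr
      exact F0P3cStCharTSEPCrossNormZeroUnr.innerG_char_cross_eq_zero_of_unramified_explicit L v hns w hw hd eA heA νQv mQv hcanQ 𝔇 hμG horb hreg hE hM1 hWIF hC1 hC2 hC3 hL2 r r' hsplit₂ hHom0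
    · have h2w : Valued.v (2 : w.1.adicCompletion L) = 1 := (valued_two_eq_one_iff_of_placesOver L w).2 h2v
      have hσ : ∀ x, (galAdicCompletionMap (L := L) (IsCMField.complexConj L) hw) ((galAdicCompletionMap (L := L) (IsCMField.complexConj L) hw) x) = x :=
        galAdicCompletionMap_galAdicCompletionMap_of_smul_eq (IsCMField.complexConj L) w hc1 hw
      have hvσ : ∀ x, Valued.v ((galAdicCompletionMap (L := L) (IsCMField.complexConj L) hw) x) = Valued.v x := fun x =>
        valued_galAdicCompletionMap (L := L) (IsCMField.complexConj L) hw x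
      obtain ⟨ϖ, hϖ, hσϖ, hres, hnorm⟩ := ramifiedBlock_adicCompletion L v w hw he h2w
      exact F0P3cStCharTSEPCrossNormZeroTame.innerG_char_cross_eq_zero_of_neg_explicit L v hns w hw hσ hvσ hϖ hσϖ hres h2w hnorm eA heA νQv mQv hcanQ 𝔇 hμG horb hreg hE hM1 hWIF hC1 hC2 hC3 hL2 r r' hsplit₂ hHom0

end Head

end Summit.HodgeConjecture.HodgeConjecture.Cruxes.H413.F0P3cStCharTSEPCrossNormZeroNotWild

end
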